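import Summits.QuantumFields.YangMills.Theorems.UnitScaleTiltProp7TwistedOneStepDefectCov
import Summits.QuantumFields.YangMills.Theorems.UnitScaleTiltProp7SymFrameRelCluster
import HarnessLib

/-!
# Route `UnitScaleTilt`, crux K1 «MinimiserStabilityRegPr» (stmt-QuantumFields-19200), E′ architecture (A′) «HCOW-VIA-Σ» (★★OWNER RULING g28-№13), package P-A2 «JOINT-Σ»,
# file F1″(cov-gauge) — THE ONE-STEP COVARIANT DEFECT IN MASS CURRENCY AT A PLAQUETTE-SMALL SU(2) BACKGROUND TOWER, BY GAUGE COVARIANCE: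
# `Σ_c ‖f_l(y)(c) − T_l y(c)‖ ≤ (80B∕R²)·2d·Σ_b ‖y b‖²` for `f_l(y)(c) = log[(dbarCovU Ū₀ˡ (e^{y}Ū₀ˡ))(c)·Ū₀^{l+1}(c)⁻¹]`, `Ū₀ˡ = emlIterU l U₀♭`, `PlaqSmall a₀ U₀`
# (the T³∕`RegPr` reading of ✓`Prop7TwistedOneStepDefectCov`: the background tower is bond-small only blockwise in a cluster axial gauge; the defect is gauge invariant)

Cell `ym3-torus`, extra width seat `ym-routeR-w6` (gen 7); ★routeR-w3 g6 LOCATE-PA2-JOINT-SIGMA (bc08ddff) §2 F1″; ★p1 g17 WORD 10 (4) pen.  THEOREMS ONLY (0 `def`, 0 `sorry`);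
`--supports stmt-QuantumFields-19200`, count-neutral.  YM₃ on T³ is a ladder rung (R3), not the Clay problem; nothing here claims a stub, the crux, d = 4 or the mass gap.

THE POINT.  [Balaban1985Averaging] p. 44: «all operations … are done always in a case where proper expressions are small» — in a convenient gauge.  The one-step chart is
gauge COVARIANT as an algebraic identity (no smallness): with `(Ad_u y)(b) = u(b₋)·y(b)·u(b₋)⁻¹`,
`f_{V^u}(Ad_u y)(c) = u(emb c₋)·f_V(y)(c)·u(emb c₋)⁻¹` (✓`Prop7SymFrameCovariance.dbarCovU_gaugeActT`, ✓`Prop8Chart.emlAvgU_gaugeActT`, ✓`B12Membership314.exp_units_conj'`, ✓`ExpMeanLog.mlog_conj`),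
hence so is its derivative at `0` (chain rule along complex lines), hence `‖f_V(y)(c) − Df_V(0)y‖ ≤ ‖f_{V^u}(Ad_u y)(c) − Df_{V^u}(0)(Ad_u y)‖` for `U1`-valued `u`, and the right side is
✓`Prop7TwistedOneStepDefectCov.norm_chart_sub_fderiv_le_localMass` as soon as `V^u` is bond-small on the read set of `c` — which W2 (✓`Prop8Chart.norm_emlIterU_sub_one_le_of_reads`)
supplies for the tower `V = emlIterU l U₀♭` in ★w4 g2's CLUSTER AXIAL GAUGE (✓`IterPlaqSmallAllL.dist1_axial_cluster_le`), exactly as in W3 ✓`Prop7SymFrameRelCluster`.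

WHAT IS PROVED (ns `…Theorems.Prop7TwistedOneStepDefectCovGauge`).
* §1 (generic complete normed ℂ-algebra `𝔸`, `‖1‖ = 1`, level `j`) `pert_conj` (`e^{Ad_u y}·V^u = (e^{y}V)^u` bondwise), ★`chart_gaugeActT_conj` (the covariance identity above, every `y`),
  `differentiableAt_conjField`, `norm_conj_le_and_ge`, `differentiableAt_chart_zero_of_gauge`, ★★`norm_chart_sub_fderiv_le_of_gauge` (per bond: the ✓cov row transported through any `U1`-valued gauge in which the background is bond-small on the read set).
* §2 (`M₂(ℂ)`, SU(2), `PlaqSmall a₀ U₀`, level `l + 2 ≤ m + K`) `transfUp_toUnits_mem_U1`, ★`norm_bgTower_gauged_sub_one_le_of_plaqSmall` (the background tower is bond-small on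
  the two blocks of `c` in the cluster axial gauge at `c₋`), ★★`norm_chart_sub_fderiv_le_localMass_of_plaqSmall` (per coarse bond),
  ★★★`sum_norm_chart_sub_fderiv_le_of_plaqSmall` (summed: the `hr : r_l ≤ C_D·M_l` row of ✓`jointRow_of_levelMasses` for the (A′) tower at a plaquette-small background),
  `differentiableAt_chart_zero_of_plaqSmall` + ★★★`sum_norm_chartField_sub_fderiv_apply_le_of_plaqSmall` (the same with `T_l := fderiv` of the FIELD-valued map, F0″'s letter),
  with `s₀ := 30ℓLˡ·s_B`, `s_B := 2d(3L^{l+1} − 1)a₀`, budgets `6400ℓ²Lˡs_B ≤ 1`, `1000ℓ(2s₀ + 3R) ≤ 1`, `2s < R`.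
HONEST SCOPE.  Bookkeeping over landed W2∕W3∕W4∕Cauchy∕covariance letters; constants crude; the `RegPr F n K ε₀` member reading (`a₀ := regThreshold`, `bgUnits`, k-uniform numerals) = px15 g3's pen.
References: T. Bałaban, CMP 98 (1985) 17–51 [Balaban1985Averaging] ((11)–(12) p.19, (21)–(22) p.21, (89) p.31, (121)–(125) p.36, (161)–(163) p.42, p.44); CMP 102 (1985) 277–309
[Balaban1985Variational] ((44)–(46) p.285, Prop. 7 p.299); CMP 109 (1987) 249–301 [Balaban1987RG1] ((0.4) p.253). -/

set_option autoImplicit false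
noncomputable section
open scoped BigOperators
open NormedSpace Metric Set Finset

namespace Summit.QuantumFields.YangMills.Theorems.Prop7TwistedOneStepDefectCovGauge

open Literature.MathematicalPhysics.QuantumFieldTheory.Balaban1983to89
open T4Continuum BlockAveraging AveragingRT ExpMeanLog MatrixLog
open B5Eq118OneStroke (iterBlockOf iterBlockOf_succ)
open B15DeterminingSets (embIter)
open B7Prop1Explicit (expUnit val_expUnit U1 mem_U1)
open B7Prop2SpecialUnitary (specialUnitaryUnits mem_specialUnitaryUnits specialUnitaryUnits_le_U1)
open B10Eq27TorusAxialLog (axialT gaugeActT gaugeActT_apply unitsField toUField suIncl)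
open Summit.QuantumFields.YangMills.Theorems.Prop8Chart (emlAvgU emlIterU emlIterU_succ emlAvgU_gaugeActT emlIterU_gaugeActT norm_emlIterU_sub_one_le_of_reads coe_unitsField_toUField)
open Summit.QuantumFields.YangMills.Theorems.IterPlaqSmallAllL (dist1_axial_cluster_le)
open Summit.QuantumFields.YangMills.Theorems.Prop7SymAvgRelativeBound (unitsField_toUField_gaugeActT)
open Summit.QuantumFields.YangMills.Theorems.Prop7SymAvgTwSym (dbarCovU)
open Summit.QuantumFields.YangMills.Theorems.Prop7SymFrameCovariance (dbarCovU_gaugeActT)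
open Summit.QuantumFields.YangMills.Theorems.Prop7TwistedOneStepDefectFlat (sum_read_le_two_d_mul)
open Summit.QuantumFields.YangMills.Theorems.Prop7TwistedOneStepDefectCov (analyticAt_chart norm_chart_sub_fderiv_le_localMass)

/-! ## §1 Gauge covariance of the one-step chart and of its derivative (generic algebra) -/

section Generic

variable {P : Params} {j : ℕ}
variable {𝔸 : Type*} [NormedRing 𝔸] [NormedAlgebra ℂ 𝔸] [CompleteSpace 𝔸] [NormOneClass 𝔸]

omit [NormOneClass 𝔸] in
/-- **THE CONJUGATED PERTURBATION OVER THE GAUGED BACKGROUND IS THE GAUGED PERTURBED FIELD**: `e^{u(b₋)y(b)u(b₋)⁻¹}·(V^u)(b) = (e^{y}V)^u(b)` (`exp_units_conj`).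
[cite: Balaban1985Averaging, (11)–(12) p.19] -/
theorem pert_conj (u : GaugeTransf P j 𝔸ˣ) (V : GaugeField P j 𝔸ˣ) (y : PBond P j → 𝔸) :
    (fun b : PBond P j => expUnit (((u b.src : 𝔸ˣ) : 𝔸) * y b * (((u b.src)⁻¹ : 𝔸ˣ) : 𝔸)) * gaugeActT u V b) =
      gaugeActT u (fun b => expUnit (y b) * V b) := by
  funext b
  apply Units.ext
  rw [gaugeActT_apply, gaugeActT_apply, Units.val_mul, val_expUnit, B12Membership314.exp_units_conj']
  push_cast
  rw [val_expUnit]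
  simp only [mul_assoc, Units.inv_mul_cancel_left]

omit [NormOneClass 𝔸] in
/-- ★ **GAUGE COVARIANCE OF THE ONE-STEP CHART** (an algebraic identity, every `y`): `f_{V^u}(Ad_u y)(c) = u(emb c₋)·f_V(y)(c)·u(emb c₋)⁻¹`.
[cite: Balaban1985Averaging, (11)–(12) p.19, (21)–(22) p.21, (89) p.31] -/
theorem chart_gaugeActT_conj (u : GaugeTransf P j 𝔸ˣ) (V : GaugeField P j 𝔸ˣ) (y : PBond P j → 𝔸) (c : PBond P (j + 1)) :
    mlog (((dbarCovU (gaugeActT u V) (fun b => expUnit (((u b.src : 𝔸ˣ) : 𝔸) * y b * (((u b.src)⁻¹ : 𝔸ˣ) : 𝔸)) * gaugeActT u V b) c : 𝔸ˣ) : 𝔸) *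
        (((emlAvgU (gaugeActT u V) c)⁻¹ : 𝔸ˣ) : 𝔸)) =
      ((u (emb c.src) : 𝔸ˣ) : 𝔸) *
        mlog (((dbarCovU V (fun b => expUnit (y b) * V b) c : 𝔸ˣ) : 𝔸) * (((emlAvgU V c)⁻¹ : 𝔸ˣ) : 𝔸)) *
        (((u (emb c.src))⁻¹ : 𝔸ˣ) : 𝔸) := by
  rw [pert_conj, dbarCovU_gaugeActT, emlAvgU_gaugeActT, ← mlog_conj (Units.mul_inv (u (emb c.src))) (Units.inv_mul (u (emb c.src)))]
  congr 1
  rw [gaugeActT_apply, gaugeActT_apply, mul_inv_rev, mul_inv_rev, inv_inv]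
  push_cast
  simp only [mul_assoc, Units.inv_mul_cancel_left]

omit [CompleteSpace 𝔸] [NormOneClass 𝔸] in
/-- The bondwise conjugation `y ↦ (b ↦ u(b₋)·y(b)·u(b₋)⁻¹)` is differentiable (it is linear). [folklore] -/
theorem differentiableAt_conjField (u : GaugeTransf P j 𝔸ˣ) (y₀ : PBond P j → 𝔸) :
    DifferentiableAt ℂ (fun (y : PBond P j → 𝔸) (b : PBond P j) => ((u b.src : 𝔸ˣ) : 𝔸) * y b * (((u b.src)⁻¹ : 𝔸ˣ) : 𝔸)) y₀ :=
  differentiableAt_pi.2 fun b =>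
    ((differentiableAt_const _).mul ((ContinuousLinearMap.proj (R := ℂ) (φ := fun _ : PBond P j => 𝔸) b).differentiableAt)).mul
      (differentiableAt_const _)

omit [NormedAlgebra ℂ 𝔸] [CompleteSpace 𝔸] in
/-- `‖u·X·u⁻¹‖ ≤ ‖X‖` and `‖X‖ ≤ ‖u·X·u⁻¹‖` for `u ∈ U1`. [folklore] -/
theorem norm_conj_le_and_ge {u : 𝔸ˣ} (hu : u ∈ U1 𝔸) (X : 𝔸) :
    ‖(u : 𝔸) * X * ((u⁻¹ : 𝔸ˣ) : 𝔸)‖ ≤ ‖X‖ ∧ ‖X‖ ≤ ‖(u : 𝔸) * X * ((u⁻¹ : 𝔸ˣ) : 𝔸)‖ := by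
  have h1 := (mem_U1.1 hu).1
  have h2 := (mem_U1.1 hu).2
  have hle : ∀ (v : 𝔸ˣ), ‖(v : 𝔸)‖ ≤ 1 → ‖((v⁻¹ : 𝔸ˣ) : 𝔸)‖ ≤ 1 → ∀ Z : 𝔸, ‖(v : 𝔸) * Z * ((v⁻¹ : 𝔸ˣ) : 𝔸)‖ ≤ ‖Z‖ := by
    intro v hv hv' Z
    calc _ ≤ ‖(v : 𝔸)‖ * ‖Z‖ * ‖((v⁻¹ : 𝔸ˣ) : 𝔸)‖ := (norm_mul_le _ _).trans (mul_le_mul_of_nonneg_right (norm_mul_le _ _) (norm_nonneg _))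
      _ ≤ 1 * ‖Z‖ * 1 := by gcongr
      _ = ‖Z‖ := by ring
  refine ⟨hle u h1 h2 X, ?_⟩
  have h := hle u⁻¹ h2 (by rw [inv_inv]; exact h1) ((u : 𝔸) * X * ((u⁻¹ : 𝔸ˣ) : 𝔸))
  rw [inv_inv] at h
  have e : ((u⁻¹ : 𝔸ˣ) : 𝔸) * ((u : 𝔸) * X * ((u⁻¹ : 𝔸ˣ) : 𝔸)) * (u : 𝔸) = X := by
    simp only [← mul_assoc, Units.inv_mul, one_mul]; rw [mul_assoc, Units.inv_mul, mul_one]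
  rw [e] at h
  exact h

/-- **DIFFERENTIABILITY AT `0` THROUGH A GAUGE**: if the gauged background `V^u` is within `s₀` of `1` on the read set of `c` (window `1000ℓ(2s₀+3R) ≤ 1`, `0 < R`), the chart of `V`
at `c` is differentiable at `0` — `f_V = Ad_{u(emb c₋)}⁻¹ ∘ f_{V^u} ∘ Ad_u` with `f_{V^u}` analytic at `0` (✓`analyticAt_chart`). [cite: Balaban1985Averaging, (11)–(12) p.19, p.44] -/
theorem differentiableAt_chart_zero_of_gauge (hj : j + 1 ≤ P.m + P.K) (u : GaugeTransf P j 𝔸ˣ) (V : GaugeField P j 𝔸ˣ) (c : PBond P (j + 1))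
    {s₀ R : ℝ} (hs₀ : 0 ≤ s₀) (hR : 0 < R) (hwin : 1000 * (((P.d + 2) * P.L : ℕ) : ℝ) * (2 * s₀ + 3 * R) ≤ 1)
    (hVu : ∀ b : PBond P j, (blockOf b.src = c.src ∨ blockOf b.src = c.tgt) → (blockOf b.tgt = c.src ∨ blockOf b.tgt = c.tgt) →
      ‖((gaugeActT u V b : 𝔸ˣ) : 𝔸) - 1‖ ≤ s₀) :
    DifferentiableAt ℂ (fun y : PBond P j → 𝔸 =>
      mlog (((dbarCovU V (fun b => expUnit (y b) * V b) c : 𝔸ˣ) : 𝔸) * (((emlAvgU V c)⁻¹ : 𝔸ˣ) : 𝔸))) 0 := by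
  set Gu : (PBond P j → 𝔸) → 𝔸 := fun y =>
    mlog (((dbarCovU (gaugeActT u V) (fun b => expUnit (y b) * gaugeActT u V b) c : 𝔸ˣ) : 𝔸) * (((emlAvgU (gaugeActT u V) c)⁻¹ : 𝔸ˣ) : 𝔸)) with hGudef
  set Ad : (PBond P j → 𝔸) → (PBond P j → 𝔸) := fun y b => ((u b.src : 𝔸ˣ) : 𝔸) * y b * (((u b.src)⁻¹ : 𝔸ˣ) : 𝔸) with hAd
  set w : 𝔸ˣ := u (emb c.src) with hw
  have hcov' : ∀ y' : PBond P j → 𝔸, mlog (((dbarCovU V (fun b => expUnit (y' b) * V b) c : 𝔸ˣ) : 𝔸) * (((emlAvgU V c)⁻¹ : 𝔸ˣ) : 𝔸)) =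
      ((w⁻¹ : 𝔸ˣ) : 𝔸) * Gu (Ad y') * (w : 𝔸) := by
    intro y'
    have h : Gu (Ad y') = (w : 𝔸) * mlog (((dbarCovU V (fun b => expUnit (y' b) * V b) c : 𝔸ˣ) : 𝔸) * (((emlAvgU V c)⁻¹ : 𝔸ˣ) : 𝔸)) * ((w⁻¹ : 𝔸ˣ) : 𝔸) :=
      chart_gaugeActT_conj u V y' c
    rw [h]; simp only [← mul_assoc, Units.inv_mul, one_mul]; rw [mul_assoc, Units.inv_mul, mul_one]
  have hAd0 : Ad 0 = 0 := by funext b; simp [hAd]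
  have hGu_an : DifferentiableAt ℂ Gu 0 :=
    (analyticAt_chart hj (gaugeActT u V) c hs₀ hwin hVu (y₀ := 0) (by rw [norm_zero]; exact hR)).differentiableAt
  have hGuAd : DifferentiableAt ℂ (fun y' => Gu (Ad y')) 0 := by
    have h1 : DifferentiableAt ℂ Gu (Ad 0) := by rw [hAd0]; exact hGu_an
    exact h1.comp 0 (differentiableAt_conjField u 0)
  rw [show (fun y : PBond P j → 𝔸 => mlog (((dbarCovU V (fun b => expUnit (y b) * V b) c : 𝔸ˣ) : 𝔸) * (((emlAvgU V c)⁻¹ : 𝔸ˣ) : 𝔸))) =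
    fun y' => ((w⁻¹ : 𝔸ˣ) : 𝔸) * Gu (Ad y') * (w : 𝔸) from funext hcov']
  exact ((differentiableAt_const _).mul hGuAd).mul (differentiableAt_const _)

/-- ★★ **THE COVARIANT DEFECT ROW TRANSPORTED THROUGH A GAUGE** — if `u` is `U1`-valued and the GAUGED background `V^u` is within `s₀` of `1` on the read set of `c`, then for
`‖y b‖ ≤ s` on the read set (`2s < R`, `1000ℓ(2s₀+3R) ≤ 1`):
`‖f_V(y)(c) − Df_V(0)·y‖ ≤ (80B∕R²)·Σ_{b read by c}‖y b‖²` — by covariance `f_V = Ad_{u(emb c₋)}⁻¹ ∘ f_{V^u} ∘ Ad_u`, the chain rule along complex lines, `U1`-contraction of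
conjugations, and ✓`norm_chart_sub_fderiv_le_localMass` at `(V^u, Ad_u y)`. [cite: Balaban1985Averaging, (11)–(12) p.19, p.44, (89) p.31, (121)–(125) p.36] -/
theorem norm_chart_sub_fderiv_le_of_gauge (hj : j + 1 ≤ P.m + P.K) (u : GaugeTransf P j 𝔸ˣ) (hu : ∀ x, u x ∈ U1 𝔸) (V : GaugeField P j 𝔸ˣ) (c : PBond P (j + 1))
    {s₀ R s : ℝ} (hs₀ : 0 ≤ s₀) (hR : 0 < R) (hwin : 1000 * (((P.d + 2) * P.L : ℕ) : ℝ) * (2 * s₀ + 3 * R) ≤ 1) (hs : 0 ≤ s) (hsR : 2 * s < R)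
    (hVu : ∀ b : PBond P j, (blockOf b.src = c.src ∨ blockOf b.src = c.tgt) → (blockOf b.tgt = c.src ∨ blockOf b.tgt = c.tgt) →
      ‖((gaugeActT u V b : 𝔸ˣ) : 𝔸) - 1‖ ≤ s₀)
    {y : PBond P j → 𝔸}
    (hy : ∀ b : PBond P j, (blockOf b.src = c.src ∨ blockOf b.src = c.tgt) → (blockOf b.tgt = c.src ∨ blockOf b.tgt = c.tgt) → ‖y b‖ ≤ s) :
    ‖mlog (((dbarCovU V (fun b => expUnit (y b) * V b) c : 𝔸ˣ) : 𝔸) * (((emlAvgU V c)⁻¹ : 𝔸ˣ) : 𝔸)) -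
        fderiv ℂ (fun y : PBond P j → 𝔸 =>
          mlog (((dbarCovU V (fun b => expUnit (y b) * V b) c : 𝔸ˣ) : 𝔸) * (((emlAvgU V c)⁻¹ : 𝔸ˣ) : 𝔸))) 0 y‖ ≤
      80 * ((P.L : ℝ) * (3 * R) + 22100 * (((P.d + 2) * P.L : ℕ) : ℝ) ^ 2 * (s₀ + (s₀ + 3 * R)) ^ 2) / R ^ 2 *
        ∑ b ∈ (univ.filter fun b : PBond P j =>
          (blockOf b.src = c.src ∨ blockOf b.src = c.tgt) ∧ (blockOf b.tgt = c.src ∨ blockOf b.tgt = c.tgt)), ‖y b‖ ^ 2 := by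
  classical
  -- letters: the two charts, the field conjugation, the site conjugator
  set G : (PBond P j → 𝔸) → 𝔸 := fun y =>
    mlog (((dbarCovU V (fun b => expUnit (y b) * V b) c : 𝔸ˣ) : 𝔸) * (((emlAvgU V c)⁻¹ : 𝔸ˣ) : 𝔸)) with hGdef
  set Gu : (PBond P j → 𝔸) → 𝔸 := fun y =>
    mlog (((dbarCovU (gaugeActT u V) (fun b => expUnit (y b) * gaugeActT u V b) c : 𝔸ˣ) : 𝔸) * (((emlAvgU (gaugeActT u V) c)⁻¹ : 𝔸ˣ) : 𝔸)) with hGudef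
  set Ad : (PBond P j → 𝔸) → (PBond P j → 𝔸) := fun y b => ((u b.src : 𝔸ˣ) : 𝔸) * y b * (((u b.src)⁻¹ : 𝔸ˣ) : 𝔸) with hAd
  set w : 𝔸ˣ := u (emb c.src) with hw
  have hcov : ∀ y' : PBond P j → 𝔸, Gu (Ad y') = (w : 𝔸) * G y' * ((w⁻¹ : 𝔸ˣ) : 𝔸) := fun y' => chart_gaugeActT_conj u V y' c
  have hcov' : ∀ y' : PBond P j → 𝔸, G y' = ((w⁻¹ : 𝔸ˣ) : 𝔸) * Gu (Ad y') * (w : 𝔸) := by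
    intro y'
    rw [hcov y']
    simp only [← mul_assoc, Units.inv_mul, one_mul]; rw [mul_assoc, Units.inv_mul, mul_one]
  have hAd0 : Ad 0 = 0 := by funext b; simp [hAd]
  have hAdsmul : ∀ (t : ℂ) (y' : PBond P j → 𝔸), Ad (t • y') = t • Ad y' := by
    intro t y'; funext b; simp only [hAd, Pi.smul_apply, mul_smul_comm, smul_mul_assoc]
  -- the gauged data satisfy the hypotheses of the cov row
  have hAdy : ∀ b : PBond P j, (blockOf b.src = c.src ∨ blockOf b.src = c.tgt) → (blockOf b.tgt = c.src ∨ blockOf b.tgt = c.tgt) → ‖Ad y b‖ ≤ s :=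
    fun b h1 h2 => ((norm_conj_le_and_ge (hu b.src) (y b)).1).trans (hy b h1 h2)
  -- differentiability of `Gu` at `0` (small gauged background) and of `G` at `0` (by the covariance identity)
  have hGu_an : DifferentiableAt ℂ Gu 0 :=
    (analyticAt_chart hj (gaugeActT u V) c hs₀ hwin hVu (y₀ := 0) (by rw [norm_zero]; exact hR)).differentiableAt
  have hGuAd : DifferentiableAt ℂ (fun y' => Gu (Ad y')) 0 := by
    have h1 : DifferentiableAt ℂ Gu (Ad 0) := by rw [hAd0]; exact hGu_an
    exact h1.comp 0 (differentiableAt_conjField u 0)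
  have hGfun : G = fun y' => ((w⁻¹ : 𝔸ˣ) : 𝔸) * Gu (Ad y') * (w : 𝔸) := funext hcov'
  have hG_diff : DifferentiableAt ℂ G 0 := by
    rw [hGfun]; exact ((differentiableAt_const _).mul hGuAd).mul (differentiableAt_const _)
  -- the derivative is covariant: `DG(0)·y = w⁻¹·(DGu(0)·(Ad y))·w` (chain rule along the complex line `t ↦ t•y`)
  have hline1 : HasDerivAt (fun t : ℂ => G (t • y)) (fderiv ℂ G 0 y) 0 := by
    have hp : HasDerivAt (fun t : ℂ => t • y) y 0 := by simpa using (hasDerivAt_id (0 : ℂ)).smul_const y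
    exact HasFDerivAt.comp_hasDerivAt_of_eq 0 hG_diff.hasFDerivAt hp (by rw [zero_smul])
  have hline2 : HasDerivAt (fun t : ℂ => G (t • y)) (((w⁻¹ : 𝔸ˣ) : 𝔸) * fderiv ℂ Gu 0 (Ad y) * (w : 𝔸)) 0 := by
    have hp : HasDerivAt (fun t : ℂ => t • Ad y) (Ad y) 0 := by simpa using (hasDerivAt_id (0 : ℂ)).smul_const (Ad y)
    have h1 : HasDerivAt (fun t : ℂ => Gu (t • Ad y)) (fderiv ℂ Gu 0 (Ad y)) 0 :=
      HasFDerivAt.comp_hasDerivAt_of_eq 0 hGu_an.hasFDerivAt hp (by rw [zero_smul])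
    have h2 := (h1.const_mul ((w⁻¹ : 𝔸ˣ) : 𝔸)).mul_const (w : 𝔸)
    have hfun : (fun t : ℂ => G (t • y)) = fun t => ((w⁻¹ : 𝔸ˣ) : 𝔸) * Gu (t • Ad y) * (w : 𝔸) := by
      funext t; rw [hcov' (t • y), hAdsmul]
    rw [hfun]; exact h2
  have hD : fderiv ℂ G 0 y = ((w⁻¹ : 𝔸ˣ) : 𝔸) * fderiv ℂ Gu 0 (Ad y) * (w : 𝔸) := hline1.unique hline2
  -- conjugate the cov row
  have hval : G y - fderiv ℂ G 0 y = ((w⁻¹ : 𝔸ˣ) : 𝔸) * (Gu (Ad y) - fderiv ℂ Gu 0 (Ad y)) * (((w⁻¹)⁻¹ : 𝔸ˣ) : 𝔸) := by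
    rw [hcov' y, hD, inv_inv, mul_sub, sub_mul]
  have hrow := norm_chart_sub_fderiv_le_localMass hj (gaugeActT u V) c hs₀ hR hwin hs hsR hVu hAdy
  have hn : ‖G y - fderiv ℂ G 0 y‖ ≤ ‖Gu (Ad y) - fderiv ℂ Gu 0 (Ad y)‖ := by
    rw [hval]; exact (norm_conj_le_and_ge ((U1 𝔸).inv_mem (hu (emb c.src))) _).1
  rw [show mlog (((dbarCovU V (fun b => expUnit (y b) * V b) c : 𝔸ˣ) : 𝔸) * (((emlAvgU V c)⁻¹ : 𝔸ˣ) : 𝔸)) - fderiv ℂ G 0 y =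
    G y - fderiv ℂ G 0 y from rfl]
  refine hn.trans (hrow.trans (mul_le_mul_of_nonneg_left (Finset.sum_le_sum fun b hb => ?_) (by positivity)))
  rw [Finset.mem_filter] at hb
  exact pow_le_pow_left₀ (norm_nonneg _) ((norm_conj_le_and_ge (hu b.src) (y b)).1) 2

end Generic

/-! ## §2 The SU(2) tower at a plaquette-small background: cluster axial gauge + W2 -/

section SU2

open scoped Matrix.Norms.L2Operator

variable {P : Params}

/-- The coherent gauge maps above an `SU(2)`-valued level-0 gauge transformation are `U1`-valued at every level. [cite: Balaban1985Averaging, (11)–(12) p.19] -/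
theorem transfUp_toUnits_mem_U1 (u : GaugeTransf P 0 (Matrix.specialUnitaryGroup (Fin 2) ℂ)) (i : ℕ) (w : Site P i) :
    transfUp (fun x => Unitary.toUnits (suIncl (u x)) : GaugeTransf P 0 (Matrix (Fin 2) (Fin 2) ℂ)ˣ) i w ∈ U1 (Matrix (Fin 2) (Fin 2) ℂ) := by
  have htr : ∀ (i : ℕ) (w : Site P i), transfUp (fun x => Unitary.toUnits (suIncl (u x)) : GaugeTransf P 0 (Matrix (Fin 2) (Fin 2) ℂ)ˣ) i w =
      Unitary.toUnits (suIncl (transfUp u i w)) := by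
    intro i
    induction i with
    | zero => intro w; rfl
    | succ i ih => intro w; exact ih (emb w)
  exact specialUnitaryUnits_le_U1 (by rw [htr, mem_specialUnitaryUnits]; exact (transfUp u i w).2)

/-- ★ **THE BACKGROUND TOWER IS BOND-SMALL ON THE TWO BLOCKS OF `c` IN THE CLUSTER AXIAL GAUGE AT `c₋`**: for `PlaqSmall a₀ U₀`, `s_B := 2d(3L^{l+1} − 1)a₀`, budget `6400ℓ²Lˡs_B ≤ 1`,
with `û := (axialT U₀ (embIter (l+1) c₋))♭` and its coherent lifts `transfUp û`: `‖(Ū₀ˡ)^{transfUp û l}(b) − 1‖ ≤ 30ℓLˡ·s_B` on every level-`l` bond `b` with both ends in the blocks of `c`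
(★w4 g2 ✓`dist1_axial_cluster_le` ∘ W2 ✓`norm_emlIterU_sub_one_le_of_reads` ∘ covariance ✓`emlIterU_gaugeActT`). [cite: Balaban1985Averaging, (11)–(12) p.19, (161)–(163) p.42, p.44] -/
theorem norm_bgTower_gauged_sub_one_le_of_plaqSmall {l : ℕ} (hl : l + 2 ≤ P.m + P.K) (U₀ : GaugeField P 0 (Matrix.specialUnitaryGroup (Fin 2) ℂ))
    {a₀ : ℝ} (ha₀ : 0 < a₀) (hU : PlaqSmall a₀ U₀)
    (hbud₀ : 6400 * (((P.d + 2) * P.L : ℕ) : ℝ) ^ 2 * (P.L : ℝ) ^ l * (2 * ((P.d : ℝ) * (3 * (P.L : ℝ) ^ (l + 1) - 1)) * a₀) ≤ 1)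
    (c : PBond P (l + 1)) (b : PBond P l) (h1 : blockOf b.src = c.src ∨ blockOf b.src = c.tgt) (h2 : blockOf b.tgt = c.src ∨ blockOf b.tgt = c.tgt) :
    ‖((gaugeActT (transfUp (fun x => Unitary.toUnits (suIncl (axialT U₀ (embIter (l + 1) c.src) x)) : GaugeTransf P 0 (Matrix (Fin 2) (Fin 2) ℂ)ˣ) l)
          (emlIterU l (unitsField (toUField U₀))) b : (Matrix (Fin 2) (Fin 2) ℂ)ˣ) : Matrix (Fin 2) (Fin 2) ℂ) - 1‖ ≤
      30 * (((P.d + 2) * P.L : ℕ) : ℝ) * (P.L : ℝ) ^ l * (2 * ((P.d : ℝ) * (3 * (P.L : ℝ) ^ (l + 1) - 1)) * a₀) := by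
  set sB : ℝ := 2 * ((P.d : ℝ) * (3 * (P.L : ℝ) ^ (l + 1) - 1)) * a₀ with hsB
  set z := c.src with hz
  set u : GaugeTransf P 0 (Matrix.specialUnitaryGroup (Fin 2) ℂ) := axialT U₀ (embIter (l + 1) z) with hu
  set û : GaugeTransf P 0 (Matrix (Fin 2) (Fin 2) ℂ)ˣ := fun x => Unitary.toUnits (suIncl (u x)) with hû
  set V₂ : GaugeField P 0 (Matrix (Fin 2) (Fin 2) ℂ)ˣ := unitsField (toUField U₀) with hV₂
  have hL1 : (1 : ℝ) ≤ P.L := by exact_mod_cast P.L_pos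
  have hsB0 : 0 ≤ sB := by
    rw [hsB]
    have h3 : (0 : ℝ) ≤ 3 * (P.L : ℝ) ^ (l + 1) - 1 := by linarith [one_le_pow₀ (n := l + 1) hL1]
    positivity
  have hus : ∀ (i : ℕ) (w : Site P (i + 1)), transfUp û (i + 1) w = transfUp û i (emb w) := fun _ _ => rfl
  -- the territory at level `l`: the two blocks of `c`; reads of the gauged level-0 background under it (cluster axial gauge at `z = c₋`)
  set S : Set (Site P l) := {w | blockOf w = c.src ∨ blockOf w = c.tgt} with hS
  have hclu : ∀ x : Site P 0, iterBlockOf l x ∈ S →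
      iterBlockOf (l + 1) x = z ∨ iterBlockOf (l + 1) x = z.shift c.dir ∨ iterBlockOf (l + 1) x = z.shift c.dir ∨ iterBlockOf (l + 1) x = (z.shift c.dir).shift c.dir := by
    intro x hx
    rw [iterBlockOf_succ]
    rcases hx with h | h
    · exact Or.inl (h.trans hz.symm)
    · exact Or.inr (Or.inl h)
  have hreads₂ : ∀ b₀ : PBond P 0, iterBlockOf l b₀.src ∈ S → iterBlockOf l b₀.tgt ∈ S →
      ‖((gaugeActT û V₂ b₀ : (Matrix (Fin 2) (Fin 2) ℂ)ˣ) : Matrix (Fin 2) (Fin 2) ℂ) - 1‖ ≤ sB := by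
    intro b₀ hbs hbt
    rw [hû, hV₂, ← unitsField_toUField_gaugeActT, coe_unitsField_toUField, ← SU2Mean.dist1_eq_norm, hu]
    exact dist1_axial_cluster_le hl U₀ ha₀ hU z c.dir c.dir b₀ (hclu _ hbs) (hclu _ hbt)
  -- W2 for the gauged background, then covariance of the tower
  have hbud₀' : 6400 * (((P.d + 2) * P.L : ℕ) : ℝ) ^ 2 * (P.L : ℝ) ^ l * sB ≤ 1 := hbud₀
  have hW2 := norm_emlIterU_sub_one_le_of_reads (by omega : l ≤ P.m + P.K) S (gaugeActT û V₂) hsB0 hbud₀' hreads₂ b h1 h2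
  have hcovT : emlIterU l (gaugeActT û V₂) = gaugeActT (transfUp û l) (emlIterU l V₂) := emlIterU_gaugeActT (transfUp û) hus V₂ l
  rw [hcovT] at hW2
  exact hW2

/-- ★★ **THE ONE-STEP COVARIANT DEFECT AT LEVEL `l` OF THE TOWER OF A PLAQUETTE-SMALL SU(2) BACKGROUND, PER COARSE BOND** — `V := Ū₀ˡ = emlIterU l U₀♭`, `PlaqSmall a₀ U₀`,
`s_B := 2d(3L^{l+1} − 1)a₀`, `s₀ := 30ℓLˡs_B`, budgets `6400ℓ²Lˡs_B ≤ 1`, `1000ℓ(2s₀+3R) ≤ 1`, `‖y b‖ ≤ s` on the read set of `c`, `2s < R`: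
`‖f_V(y)(c) − Df_V(0)·y‖ ≤ (80B∕R²)·Σ_{b read by c}‖y b‖²` (§1 ★★ in the cluster axial gauge of ★`norm_bgTower_gauged_sub_one_le_of_plaqSmall`).
[cite: Balaban1985Averaging, (11)–(12) p.19, (89) p.31, (161)–(163) p.42, p.44] -/
theorem norm_chart_sub_fderiv_le_localMass_of_plaqSmall {l : ℕ} (hl : l + 2 ≤ P.m + P.K) (U₀ : GaugeField P 0 (Matrix.specialUnitaryGroup (Fin 2) ℂ))
    {a₀ : ℝ} (ha₀ : 0 < a₀) (hU : PlaqSmall a₀ U₀) {R s : ℝ} (hR : 0 < R) (hs : 0 ≤ s) (hsR : 2 * s < R)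
    (hbud₀ : 6400 * (((P.d + 2) * P.L : ℕ) : ℝ) ^ 2 * (P.L : ℝ) ^ l * (2 * ((P.d : ℝ) * (3 * (P.L : ℝ) ^ (l + 1) - 1)) * a₀) ≤ 1)
    (hwin : 1000 * (((P.d + 2) * P.L : ℕ) : ℝ) *
      (2 * (30 * (((P.d + 2) * P.L : ℕ) : ℝ) * (P.L : ℝ) ^ l * (2 * ((P.d : ℝ) * (3 * (P.L : ℝ) ^ (l + 1) - 1)) * a₀)) + 3 * R) ≤ 1)
    (c : PBond P (l + 1)) {y : PBond P l → Matrix (Fin 2) (Fin 2) ℂ}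
    (hy : ∀ b : PBond P l, (blockOf b.src = c.src ∨ blockOf b.src = c.tgt) → (blockOf b.tgt = c.src ∨ blockOf b.tgt = c.tgt) → ‖y b‖ ≤ s) :
    ‖mlog (((dbarCovU (emlIterU l (unitsField (toUField U₀))) (fun b => expUnit (y b) * emlIterU l (unitsField (toUField U₀)) b) c :
            (Matrix (Fin 2) (Fin 2) ℂ)ˣ) : Matrix (Fin 2) (Fin 2) ℂ) *
          (((emlAvgU (emlIterU l (unitsField (toUField U₀))) c)⁻¹ : (Matrix (Fin 2) (Fin 2) ℂ)ˣ) : Matrix (Fin 2) (Fin 2) ℂ)) -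
        fderiv ℂ (fun y : PBond P l → Matrix (Fin 2) (Fin 2) ℂ =>
          mlog (((dbarCovU (emlIterU l (unitsField (toUField U₀))) (fun b => expUnit (y b) * emlIterU l (unitsField (toUField U₀)) b) c :
              (Matrix (Fin 2) (Fin 2) ℂ)ˣ) : Matrix (Fin 2) (Fin 2) ℂ) *
            (((emlAvgU (emlIterU l (unitsField (toUField U₀))) c)⁻¹ : (Matrix (Fin 2) (Fin 2) ℂ)ˣ) : Matrix (Fin 2) (Fin 2) ℂ))) 0 y‖ ≤
      80 * ((P.L : ℝ) * (3 * R) + 22100 * (((P.d + 2) * P.L : ℕ) : ℝ) ^ 2 *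
          ((30 * (((P.d + 2) * P.L : ℕ) : ℝ) * (P.L : ℝ) ^ l * (2 * ((P.d : ℝ) * (3 * (P.L : ℝ) ^ (l + 1) - 1)) * a₀)) +
            ((30 * (((P.d + 2) * P.L : ℕ) : ℝ) * (P.L : ℝ) ^ l * (2 * ((P.d : ℝ) * (3 * (P.L : ℝ) ^ (l + 1) - 1)) * a₀)) + 3 * R)) ^ 2) / R ^ 2 *
        ∑ b ∈ (univ.filter fun b : PBond P l =>
          (blockOf b.src = c.src ∨ blockOf b.src = c.tgt) ∧ (blockOf b.tgt = c.src ∨ blockOf b.tgt = c.tgt)), ‖y b‖ ^ 2 := by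
  have hL1 : (1 : ℝ) ≤ P.L := by exact_mod_cast P.L_pos
  have hs₀0 : 0 ≤ 30 * (((P.d + 2) * P.L : ℕ) : ℝ) * (P.L : ℝ) ^ l * (2 * ((P.d : ℝ) * (3 * (P.L : ℝ) ^ (l + 1) - 1)) * a₀) := by
    have h3 : (0 : ℝ) ≤ 3 * (P.L : ℝ) ^ (l + 1) - 1 := by linarith [one_le_pow₀ (n := l + 1) hL1]
    positivity
  exact norm_chart_sub_fderiv_le_of_gauge (by omega) _ (transfUp_toUnits_mem_U1 (axialT U₀ (embIter (l + 1) c.src)) l) _ c hs₀0 hR hwin hs hsR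
    (norm_bgTower_gauged_sub_one_le_of_plaqSmall hl U₀ ha₀ hU hbud₀ c) hy

/-- **DIFFERENTIABILITY AT `0` OF THE LEVEL-`l` CHART OF THE TOWER** (same gauge; the hypothesis `fderiv_pi` needs for the field-valued letter).
[cite: Balaban1985Averaging, (11)–(12) p.19, (161)–(163) p.42, p.44] -/
theorem differentiableAt_chart_zero_of_plaqSmall {l : ℕ} (hl : l + 2 ≤ P.m + P.K) (U₀ : GaugeField P 0 (Matrix.specialUnitaryGroup (Fin 2) ℂ))
    {a₀ : ℝ} (ha₀ : 0 < a₀) (hU : PlaqSmall a₀ U₀) {R : ℝ} (hR : 0 < R)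
    (hbud₀ : 6400 * (((P.d + 2) * P.L : ℕ) : ℝ) ^ 2 * (P.L : ℝ) ^ l * (2 * ((P.d : ℝ) * (3 * (P.L : ℝ) ^ (l + 1) - 1)) * a₀) ≤ 1)
    (hwin : 1000 * (((P.d + 2) * P.L : ℕ) : ℝ) *
      (2 * (30 * (((P.d + 2) * P.L : ℕ) : ℝ) * (P.L : ℝ) ^ l * (2 * ((P.d : ℝ) * (3 * (P.L : ℝ) ^ (l + 1) - 1)) * a₀)) + 3 * R) ≤ 1)
    (c : PBond P (l + 1)) :
    DifferentiableAt ℂ (fun y : PBond P l → Matrix (Fin 2) (Fin 2) ℂ =>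
      mlog (((dbarCovU (emlIterU l (unitsField (toUField U₀))) (fun b => expUnit (y b) * emlIterU l (unitsField (toUField U₀)) b) c :
          (Matrix (Fin 2) (Fin 2) ℂ)ˣ) : Matrix (Fin 2) (Fin 2) ℂ) *
        (((emlAvgU (emlIterU l (unitsField (toUField U₀))) c)⁻¹ : (Matrix (Fin 2) (Fin 2) ℂ)ˣ) : Matrix (Fin 2) (Fin 2) ℂ))) 0 := by
  have hL1 : (1 : ℝ) ≤ P.L := by exact_mod_cast P.L_pos
  have hs₀0 : 0 ≤ 30 * (((P.d + 2) * P.L : ℕ) : ℝ) * (P.L : ℝ) ^ l * (2 * ((P.d : ℝ) * (3 * (P.L : ℝ) ^ (l + 1) - 1)) * a₀) := by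
    have h3 : (0 : ℝ) ≤ 3 * (P.L : ℝ) ^ (l + 1) - 1 := by linarith [one_le_pow₀ (n := l + 1) hL1]
    positivity
  exact differentiableAt_chart_zero_of_gauge (by omega) _ _ c hs₀0 hR hwin (norm_bgTower_gauged_sub_one_le_of_plaqSmall hl U₀ ha₀ hU hbud₀ c)

/-- ★★★ **THE ONE-STEP COVARIANT DEFECT IN MASS CURRENCY ALONG THE TOWER OF A PLAQUETTE-SMALL SU(2) BACKGROUND** — summed over the coarse bonds, for `‖y b‖ ≤ s` everywhere:
`Σ_c ‖f_l(y)(c) − Df_l(0)·y (c)‖ ≤ (80B∕R²)·(2d)·Σ_b ‖y b‖²`, `f_l(y)(c) = log[(dbarCovU Ū₀ˡ (e^{y}Ū₀ˡ))(c)·(Ū₀ˡ)‾(c)⁻¹]`, `Ū₀ˡ = emlIterU l U₀♭` (`(Ū₀ˡ)‾ = Ū₀^{l+1}`, ✓`emlIterU_succ`)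
— the `hr : r_l ≤ C_D·M_l` row of ✓`Prop7JointRowOfLevelMasses.jointRow_of_levelMasses` for the (A′) tower ✓`dbarCovIterU_succ`.
[cite: Balaban1985Averaging, (11)–(12) p.19, (89) p.31, (121)–(125) p.36, (161)–(163) p.42, p.44; Balaban1985Variational, (44)–(46) p.285, Prop. 7 p.299] -/
theorem sum_norm_chart_sub_fderiv_le_of_plaqSmall {l : ℕ} (hl : l + 2 ≤ P.m + P.K) (U₀ : GaugeField P 0 (Matrix.specialUnitaryGroup (Fin 2) ℂ))
    {a₀ : ℝ} (ha₀ : 0 < a₀) (hU : PlaqSmall a₀ U₀) {R s : ℝ} (hR : 0 < R) (hs : 0 ≤ s) (hsR : 2 * s < R)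
    (hbud₀ : 6400 * (((P.d + 2) * P.L : ℕ) : ℝ) ^ 2 * (P.L : ℝ) ^ l * (2 * ((P.d : ℝ) * (3 * (P.L : ℝ) ^ (l + 1) - 1)) * a₀) ≤ 1)
    (hwin : 1000 * (((P.d + 2) * P.L : ℕ) : ℝ) *
      (2 * (30 * (((P.d + 2) * P.L : ℕ) : ℝ) * (P.L : ℝ) ^ l * (2 * ((P.d : ℝ) * (3 * (P.L : ℝ) ^ (l + 1) - 1)) * a₀)) + 3 * R) ≤ 1)
    {y : PBond P l → Matrix (Fin 2) (Fin 2) ℂ} (hy : ∀ b : PBond P l, ‖y b‖ ≤ s) :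
    ∑ c : PBond P (l + 1), ‖mlog (((dbarCovU (emlIterU l (unitsField (toUField U₀))) (fun b => expUnit (y b) * emlIterU l (unitsField (toUField U₀)) b) c :
            (Matrix (Fin 2) (Fin 2) ℂ)ˣ) : Matrix (Fin 2) (Fin 2) ℂ) *
          (((emlAvgU (emlIterU l (unitsField (toUField U₀))) c)⁻¹ : (Matrix (Fin 2) (Fin 2) ℂ)ˣ) : Matrix (Fin 2) (Fin 2) ℂ)) -
        fderiv ℂ (fun y : PBond P l → Matrix (Fin 2) (Fin 2) ℂ =>
          mlog (((dbarCovU (emlIterU l (unitsField (toUField U₀))) (fun b => expUnit (y b) * emlIterU l (unitsField (toUField U₀)) b) c :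
              (Matrix (Fin 2) (Fin 2) ℂ)ˣ) : Matrix (Fin 2) (Fin 2) ℂ) *
            (((emlAvgU (emlIterU l (unitsField (toUField U₀))) c)⁻¹ : (Matrix (Fin 2) (Fin 2) ℂ)ˣ) : Matrix (Fin 2) (Fin 2) ℂ))) 0 y‖ ≤
      80 * ((P.L : ℝ) * (3 * R) + 22100 * (((P.d + 2) * P.L : ℕ) : ℝ) ^ 2 *
          ((30 * (((P.d + 2) * P.L : ℕ) : ℝ) * (P.L : ℝ) ^ l * (2 * ((P.d : ℝ) * (3 * (P.L : ℝ) ^ (l + 1) - 1)) * a₀)) +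
            ((30 * (((P.d + 2) * P.L : ℕ) : ℝ) * (P.L : ℝ) ^ l * (2 * ((P.d : ℝ) * (3 * (P.L : ℝ) ^ (l + 1) - 1)) * a₀)) + 3 * R)) ^ 2) / R ^ 2 * (2 * P.d) *
        ∑ b : PBond P l, ‖y b‖ ^ 2 := by
  classical
  set Cst : ℝ := 80 * ((P.L : ℝ) * (3 * R) + 22100 * (((P.d + 2) * P.L : ℕ) : ℝ) ^ 2 *
          ((30 * (((P.d + 2) * P.L : ℕ) : ℝ) * (P.L : ℝ) ^ l * (2 * ((P.d : ℝ) * (3 * (P.L : ℝ) ^ (l + 1) - 1)) * a₀)) +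
            ((30 * (((P.d + 2) * P.L : ℕ) : ℝ) * (P.L : ℝ) ^ l * (2 * ((P.d : ℝ) * (3 * (P.L : ℝ) ^ (l + 1) - 1)) * a₀)) + 3 * R)) ^ 2) / R ^ 2 with hCst
  have hCst0 : 0 ≤ Cst := by rw [hCst]; positivity
  have hmult := sum_read_le_two_d_mul (P := P) (j := l) (fun b => ‖y b‖ ^ 2) (fun b => sq_nonneg _)
  calc _ ≤ ∑ c : PBond P (l + 1), Cst * ∑ b ∈ (univ.filter fun b : PBond P l =>
            (blockOf b.src = c.src ∨ blockOf b.src = c.tgt) ∧ (blockOf b.tgt = c.src ∨ blockOf b.tgt = c.tgt)), ‖y b‖ ^ 2 :=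
        Finset.sum_le_sum fun c _ => norm_chart_sub_fderiv_le_localMass_of_plaqSmall hl U₀ ha₀ hU hR hs hsR hbud₀ hwin c (fun b _ _ => hy b)
    _ = Cst * ∑ c : PBond P (l + 1), ∑ b ∈ (univ.filter fun b : PBond P l =>
            (blockOf b.src = c.src ∨ blockOf b.src = c.tgt) ∧ (blockOf b.tgt = c.src ∨ blockOf b.tgt = c.tgt)), ‖y b‖ ^ 2 := by rw [Finset.mul_sum]
    _ ≤ Cst * (2 * P.d * ∑ b : PBond P l, ‖y b‖ ^ 2) := mul_le_mul_of_nonneg_left hmult hCst0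
    _ = _ := by ring

/-- ★★★ **THE FIELD-VALUED READING** — with `f_l(y) := (c ↦ log[(dbarCovU Ū₀ˡ (e^{y}Ū₀ˡ))(c)·(Ū₀ˡ)‾(c)⁻¹])` and `T_l := fderiv ℂ f_l 0` (the continuous linear map on fields
F0″ ✓`IteratedMapTelescope` telescopes with): `Σ_c ‖f_l(y)(c) − (T_l y)(c)‖ ≤ (80B∕R²)·(2d)·Σ_b ‖y b‖²` (componentwise `fderiv_pi`).
[cite: Balaban1985Averaging, (89) p.31, (150)–(152) p.40, p.44; Balaban1985Variational, (44)–(46) p.285] -/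
theorem sum_norm_chartField_sub_fderiv_apply_le_of_plaqSmall {l : ℕ} (hl : l + 2 ≤ P.m + P.K) (U₀ : GaugeField P 0 (Matrix.specialUnitaryGroup (Fin 2) ℂ))
    {a₀ : ℝ} (ha₀ : 0 < a₀) (hU : PlaqSmall a₀ U₀) {R s : ℝ} (hR : 0 < R) (hs : 0 ≤ s) (hsR : 2 * s < R)
    (hbud₀ : 6400 * (((P.d + 2) * P.L : ℕ) : ℝ) ^ 2 * (P.L : ℝ) ^ l * (2 * ((P.d : ℝ) * (3 * (P.L : ℝ) ^ (l + 1) - 1)) * a₀) ≤ 1)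
    (hwin : 1000 * (((P.d + 2) * P.L : ℕ) : ℝ) *
      (2 * (30 * (((P.d + 2) * P.L : ℕ) : ℝ) * (P.L : ℝ) ^ l * (2 * ((P.d : ℝ) * (3 * (P.L : ℝ) ^ (l + 1) - 1)) * a₀)) + 3 * R) ≤ 1)
    {y : PBond P l → Matrix (Fin 2) (Fin 2) ℂ} (hy : ∀ b : PBond P l, ‖y b‖ ≤ s) :
    ∑ c : PBond P (l + 1), ‖mlog (((dbarCovU (emlIterU l (unitsField (toUField U₀))) (fun b => expUnit (y b) * emlIterU l (unitsField (toUField U₀)) b) c :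
            (Matrix (Fin 2) (Fin 2) ℂ)ˣ) : Matrix (Fin 2) (Fin 2) ℂ) *
          (((emlAvgU (emlIterU l (unitsField (toUField U₀))) c)⁻¹ : (Matrix (Fin 2) (Fin 2) ℂ)ˣ) : Matrix (Fin 2) (Fin 2) ℂ)) -
        fderiv ℂ (fun (y : PBond P l → Matrix (Fin 2) (Fin 2) ℂ) (c : PBond P (l + 1)) =>
          mlog (((dbarCovU (emlIterU l (unitsField (toUField U₀))) (fun b => expUnit (y b) * emlIterU l (unitsField (toUField U₀)) b) c :
              (Matrix (Fin 2) (Fin 2) ℂ)ˣ) : Matrix (Fin 2) (Fin 2) ℂ) *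
            (((emlAvgU (emlIterU l (unitsField (toUField U₀))) c)⁻¹ : (Matrix (Fin 2) (Fin 2) ℂ)ˣ) : Matrix (Fin 2) (Fin 2) ℂ))) 0 y c‖ ≤
      80 * ((P.L : ℝ) * (3 * R) + 22100 * (((P.d + 2) * P.L : ℕ) : ℝ) ^ 2 *
          ((30 * (((P.d + 2) * P.L : ℕ) : ℝ) * (P.L : ℝ) ^ l * (2 * ((P.d : ℝ) * (3 * (P.L : ℝ) ^ (l + 1) - 1)) * a₀)) +
            ((30 * (((P.d + 2) * P.L : ℕ) : ℝ) * (P.L : ℝ) ^ l * (2 * ((P.d : ℝ) * (3 * (P.L : ℝ) ^ (l + 1) - 1)) * a₀)) + 3 * R)) ^ 2) / R ^ 2 * (2 * P.d) *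
        ∑ b : PBond P l, ‖y b‖ ^ 2 := by
  have hdiff := fun c : PBond P (l + 1) => differentiableAt_chart_zero_of_plaqSmall hl U₀ ha₀ hU hR hbud₀ hwin c
  have hpi : ∀ c : PBond P (l + 1), fderiv ℂ (fun (y : PBond P l → Matrix (Fin 2) (Fin 2) ℂ) (c : PBond P (l + 1)) =>
        mlog (((dbarCovU (emlIterU l (unitsField (toUField U₀))) (fun b => expUnit (y b) * emlIterU l (unitsField (toUField U₀)) b) c :
            (Matrix (Fin 2) (Fin 2) ℂ)ˣ) : Matrix (Fin 2) (Fin 2) ℂ) *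
          (((emlAvgU (emlIterU l (unitsField (toUField U₀))) c)⁻¹ : (Matrix (Fin 2) (Fin 2) ℂ)ˣ) : Matrix (Fin 2) (Fin 2) ℂ))) 0 y c =
      fderiv ℂ (fun y : PBond P l → Matrix (Fin 2) (Fin 2) ℂ =>
        mlog (((dbarCovU (emlIterU l (unitsField (toUField U₀))) (fun b => expUnit (y b) * emlIterU l (unitsField (toUField U₀)) b) c :
            (Matrix (Fin 2) (Fin 2) ℂ)ˣ) : Matrix (Fin 2) (Fin 2) ℂ) *
          (((emlAvgU (emlIterU l (unitsField (toUField U₀))) c)⁻¹ : (Matrix (Fin 2) (Fin 2) ℂ)ˣ) : Matrix (Fin 2) (Fin 2) ℂ))) 0 y := by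
    intro c
    rw [fderiv_pi hdiff]
    rfl
  simp only [hpi]
  exact sum_norm_chart_sub_fderiv_le_of_plaqSmall hl U₀ ha₀ hU hR hs hsR hbud₀ hwin hy

end SU2

end Summit.QuantumFields.YangMills.Theorems.Prop7TwistedOneStepDefectCovGauge

end
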